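import Mathlib
import Summits.NavierStokesRegularity.NavierStokesRegularity.Theorems.FilamentSkeletonRssClause13ModelSelfForm

/-!
# Clause 13-J, brick B4/B5 (virial): the DILATION IDENTITY `2Re⟨(τ−c)Y′, Y⟩ = −‖Y‖₂²` on the line

Route `FilamentSkeletonRss`, child `Clause13NearStraightL` (stmt-NavierStokesRegularity-23321; typing-agnostic, valid verbatim for the
A1G twin 28296); design of record `filament-plan/DESIGN-NOTE-28296-tenure-g22.md` §4 ("the Mourre estimate is a 3-line virial
identity in L², conjugate operator A = τ − c … [(τ−c), −w∂_τ] = +w") and §5 ("… via Plancherel + the dilation identity for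
⟨Y, (τ−c)Y′⟩ + Poincaré on the ball").  For `Y : ℝ → ℂ` with derivative `Y′` and the obvious integrability,

  `∫ (τ−c)·(conj Y′(τ)·Y(τ) + conj Y(τ)·Y′(τ)) dτ = −∫ conj Y·Y = −‖Y‖₂²`,

i.e. `2 Re ∫ (τ−c) conj Y · Y′ = −‖Y‖₂²` — the derivative of `(τ−c)|Y|²` integrates to zero
(`MeasureTheory.integral_eq_zero_of_hasDerivAt_of_integrable`).  With a bounded multiplier `w` the same computation gives the
commutator term `[(τ−c), −w∂_τ] = w` of §4; recorded here is the `w ≡ 1` dilation piece and its real form.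
Lane ns-filament-19175-p1 g14; `--supports stmt-NavierStokesRegularity-23321 --as helper`.
HONEST FRAMING: an elementary identity attached to a HYPOTHETICAL filament skeleton's linearised operator on the NEGATIVE side of a
MODEL route; nothing here bears on Navier–Stokes regularity or blow-up.
-/

noncomputable section

open MeasureTheory Real Complex Filter Set
open scoped ComplexConjugate

namespace Summit.NavierStokesRegularity.NavierStokesRegularity.Theorems.MatchedKernel
set_option linter.dupNamespace false

/-- Derivative of `τ ↦ (τ − c)·conj Y(τ)·Y(τ)`. [folklore] -/
theorem hasDerivAt_weight_mul_conj_mul {Y Y' : ℝ → ℂ} (hY : ∀ τ, HasDerivAt Y (Y' τ) τ) (c τ : ℝ) :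
    HasDerivAt (fun s : ℝ => ((s - c : ℝ) : ℂ) * (conj (Y s) * Y s))
      (conj (Y τ) * Y τ + ((τ - c : ℝ) : ℂ) * (conj (Y' τ) * Y τ + conj (Y τ) * Y' τ)) τ := by
  have h1 : HasDerivAt (fun s : ℝ => ((s - c : ℝ) : ℂ)) 1 τ := by
    have h := ((hasDerivAt_id τ).sub_const c).ofReal_comp
    simpa using h
  have hconj : HasDerivAt (fun s : ℝ => conj (Y s)) (conj (Y' τ)) τ := (hY τ).star
  have h2 : HasDerivAt (fun s : ℝ => conj (Y s) * Y s) (conj (Y' τ) * Y τ + conj (Y τ) * Y' τ) τ :=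
    hconj.fun_mul (hY τ)
  refine (h1.fun_mul h2).congr_deriv ?_
  rw [one_mul]

/-- **DILATION IDENTITY (complex form).**  If `Y` has derivative `Y′` everywhere and `(τ−c)|Y|²`, `|Y|²`,
`(τ−c)(conj Y′·Y + conj Y·Y′)` are integrable, then `∫(τ−c)(conj Y′·Y + conj Y·Y′) = −∫ conj Y·Y`. [folklore] -/
theorem integral_weight_mul_deriv_sq_eq {Y Y' : ℝ → ℂ} (hY : ∀ τ, HasDerivAt Y (Y' τ) τ) (c : ℝ)
    (hg : Integrable (fun τ : ℝ => ((τ - c : ℝ) : ℂ) * (conj (Y τ) * Y τ)))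
    (h0 : Integrable (fun τ : ℝ => conj (Y τ) * Y τ))
    (h1 : Integrable (fun τ : ℝ => ((τ - c : ℝ) : ℂ) * (conj (Y' τ) * Y τ + conj (Y τ) * Y' τ))) :
    ∫ τ : ℝ, ((τ - c : ℝ) : ℂ) * (conj (Y' τ) * Y τ + conj (Y τ) * Y' τ) = -∫ τ : ℝ, conj (Y τ) * Y τ := by
  have hzero := integral_eq_zero_of_hasDerivAt_of_integrable (hasDerivAt_weight_mul_conj_mul hY c) (h0.add h1) hg
  rw [integral_add h0 h1] at hzero
  linear_combination hzero

/-- `conj Y′·Y + conj Y·Y′ = 2 Re(conj Y·Y′)` (as a complex number). [folklore] -/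
theorem conj_mul_add_conj_mul_eq (a b : ℂ) : conj b * a + conj a * b = ((2 * (conj a * b).re : ℝ) : ℂ) := by
  have h : conj b * a = conj (conj a * b) := by rw [map_mul, Complex.conj_conj, mul_comm]
  rw [h, add_comm, Complex.add_conj]

/-- **DILATION IDENTITY (real form)**: `∫ (τ−c)·2Re(conj Y(τ)·Y′(τ)) dτ = −∫‖Y‖²`, i.e. `2Re⟨(τ−c)Y′, Y⟩ = −‖Y‖₂²`. [folklore] -/
theorem integral_weight_mul_two_re_conj_mul_deriv {Y Y' : ℝ → ℂ} (hY : ∀ τ, HasDerivAt Y (Y' τ) τ) (c : ℝ)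
    (hg : Integrable (fun τ : ℝ => ((τ - c : ℝ) : ℂ) * (conj (Y τ) * Y τ)))
    (h0 : Integrable (fun τ : ℝ => conj (Y τ) * Y τ))
    (h1 : Integrable (fun τ : ℝ => ((τ - c : ℝ) : ℂ) * (conj (Y' τ) * Y τ + conj (Y τ) * Y' τ))) :
    ∫ τ : ℝ, (τ - c) * (2 * (conj (Y τ) * Y' τ).re) = -∫ τ : ℝ, ‖Y τ‖ ^ 2 := by
  have h := integral_weight_mul_deriv_sq_eq hY c hg h0 h1
  have hl : ∫ τ : ℝ, ((τ - c : ℝ) : ℂ) * (conj (Y' τ) * Y τ + conj (Y τ) * Y' τ)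
      = ((∫ τ : ℝ, (τ - c) * (2 * (conj (Y τ) * Y' τ).re) : ℝ) : ℂ) := by
    rw [← integral_complex_ofReal]
    refine integral_congr_ae (Eventually.of_forall fun τ => ?_)
    dsimp only
    rw [conj_mul_add_conj_mul_eq, ← Complex.ofReal_mul]
  rw [hl, integral_conj_mul_self, ← Complex.ofReal_neg] at h
  exact_mod_cast h

end Summit.NavierStokesRegularity.NavierStokesRegularity.Theorems.MatchedKernel

end
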